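import Summits.CriticalPhenomena.CardyFormulaZ2.Theorems.CardySelfRefinementCriticalPathRSWStubFiniteSizeCriteriaPieces
import Summits.CriticalPhenomena.CardyFormulaZ2.Theorems.CardySelfRefinementCriticalPathRSWStubFiniteSizeCriteriaGrids

/-!
# Finite-size criteria for `M_k`, part 4: probability estimates for an invariant, finitely
dependent lattice measure

Support file for item `stmt-CriticalPhenomena-10267` (route `CardySelfRefinement`, crux
`CriticalPathRSW`, line finite-size-envelope, stub `stub_finiteSizeCriteria`): the finite-size
criteria (H. Kesten, *Percolation theory for mathematicians* (1982), Ch. 5, Thm. 5.1; G. Grimmett,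
*Percolation* (1999), §11.7) for the `k`-dependent self-refinement laws `M_k(ρ, c)` and their duals.

For a probability measure `μ` on bond configurations of `ℤ²` which is carried by lattice
configurations (`hlat`), invariant under the translations of `kℤ²` (`hshift`) and under the
transposition of the axes (`htrans`), and sub-multiplicative on events determined by boxes at
sup-distance `> r` (`hindep`), we prove the four estimates of Kesten's finite-size criterion
(Kesten 1982, Ch. 5): the initial bound of the annulus event by four rectangle crossings
(`real_annulusCross_le_four_mul`), the renormalisation inequality
`μ(A(0; 6N, 24N)) ≤ 17689 μ(A(0; N, 4N))²` (`real_annulusCross_renorm`) and its iteration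
(`real_annulusCross_iter`), and the covering of a long crossing by annulus events of the grid
(`real_hCross_le_card_mul`); plus three arithmetic helpers for the assembly.
-/

noncomputable section

namespace Summit.CriticalPhenomena.CardyFormulaZ2.Cruxes.CriticalPathRSW.FiniteSizeEnvelope

open Set
open Literature.Probability.LatticeModels Literature.Probability.Percolation

namespace FSC

/-! ### Rectangles and crossing events (local notations)

To keep these support files free of new definitions, the four events of the argument are local
notations for explicit instances of the tree's `openCrossing S A B`:

* `rect[a, b, lo, hi]` — the lattice rectangle `[a, b] × [lo, hi] ∩ ℤ²` (a `Finset`, Mathlib's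
  order interval of `Site 2 = Fin 2 → ℤ`);
* `hCross[a, b, lo, hi]` — its **horizontal open crossing**: an open path inside the rectangle from
  the left side `{x₀ = a}` to the right side `{x₀ = b}`;
* `vCross[a, b, lo, hi]` — its **vertical open crossing**, from `{x₁ = lo}` to `{x₁ = hi}`;
* `annulusCross[c, N, R]` — the **annulus event** `A(c; N, R)` of Kesten (1982), Ch. 5: an open
  path inside the box `c + [-R, R]²` from the box `c + [-N, N]²` to the boundary of `c + [-R, R]²`. -/

local notation3 "rect[" a ", " b ", " lo ", " hi "]" =>
  (Finset.Icc ![(a : ℤ), (lo : ℤ)] ![(b : ℤ), (hi : ℤ)] : Finset (Site 2))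

local notation3 "hCross[" a ", " b ", " lo ", " hi "]" =>
  (openCrossing (↑(Finset.Icc ![(a : ℤ), (lo : ℤ)] ![(b : ℤ), (hi : ℤ)] : Finset (Site 2)) : Set (Site 2))
    {x : Site 2 | x ∈ (Finset.Icc ![(a : ℤ), (lo : ℤ)] ![(b : ℤ), (hi : ℤ)] : Finset (Site 2)) ∧ x 0 = (a : ℤ)}
    {x : Site 2 | x ∈ (Finset.Icc ![(a : ℤ), (lo : ℤ)] ![(b : ℤ), (hi : ℤ)] : Finset (Site 2)) ∧ x 0 = (b : ℤ)} :
    Set (BondConfig (Site 2)))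

local notation3 "vCross[" a ", " b ", " lo ", " hi "]" =>
  (openCrossing (↑(Finset.Icc ![(a : ℤ), (lo : ℤ)] ![(b : ℤ), (hi : ℤ)] : Finset (Site 2)) : Set (Site 2))
    {x : Site 2 | x ∈ (Finset.Icc ![(a : ℤ), (lo : ℤ)] ![(b : ℤ), (hi : ℤ)] : Finset (Site 2)) ∧ x 1 = (lo : ℤ)}
    {x : Site 2 | x ∈ (Finset.Icc ![(a : ℤ), (lo : ℤ)] ![(b : ℤ), (hi : ℤ)] : Finset (Site 2)) ∧ x 1 = (hi : ℤ)} :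
    Set (BondConfig (Site 2)))

local notation3 "annulusCross[" c ", " N ", " R "]" =>
  (openCrossing
    (↑(Finset.Icc ![(c : Site 2) 0 - ((R : ℕ) : ℤ), (c : Site 2) 1 - ((R : ℕ) : ℤ)]
        ![(c : Site 2) 0 + ((R : ℕ) : ℤ), (c : Site 2) 1 + ((R : ℕ) : ℤ)] : Finset (Site 2)) : Set (Site 2))
    (↑(Finset.Icc ![(c : Site 2) 0 - ((N : ℕ) : ℤ), (c : Site 2) 1 - ((N : ℕ) : ℤ)]
        ![(c : Site 2) 0 + ((N : ℕ) : ℤ), (c : Site 2) 1 + ((N : ℕ) : ℤ)] : Finset (Site 2)) : Set (Site 2))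
    {x : Site 2 | x ∈ (Finset.Icc ![(c : Site 2) 0 - ((R : ℕ) : ℤ), (c : Site 2) 1 - ((R : ℕ) : ℤ)]
        ![(c : Site 2) 0 + ((R : ℕ) : ℤ), (c : Site 2) 1 + ((R : ℕ) : ℤ)] : Finset (Site 2)) ∧
      (x 0 = (c : Site 2) 0 - ((R : ℕ) : ℤ) ∨ x 0 = (c : Site 2) 0 + ((R : ℕ) : ℤ) ∨
        x 1 = (c : Site 2) 1 - ((R : ℕ) : ℤ) ∨ x 1 = (c : Site 2) 1 + ((R : ℕ) : ℤ))} :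
    Set (BondConfig (Site 2)))


/-! ## Probability estimates for an invariant, finitely dependent, lattice measure

Throughout, `μ` is a probability measure on bond configurations of `ℤ²` and the hypotheses used are
(a subset of): `hlat` — `μ`-a.e. configuration is a lattice configuration; `hshift` — invariance
under the translations of `kℤ²`; `htrans` — invariance under the transposition of the axes;
`hindep` — sub-multiplicativity `μ(A ∩ B) ≤ μ(A) μ(B)` for events determined by the pairs of
vertices of two finite sets at sup-distance `> r`. -/

section Measure

open MeasureTheory

variable (μ : Measure (BondConfig (Site 2))) [IsProbabilityMeasure μ]

/-- An inclusion valid on lattice configurations gives an inequality of probabilities. -/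
theorem real_mono_of_lattice (hlat : ∀ᵐ ω ∂μ, ω ⊆ (zdGraph 2).edgeSet)
    {A B : Set (BondConfig (Site 2))}
    (h : ∀ ω : BondConfig (Site 2), ω ⊆ (zdGraph 2).edgeSet → ω ∈ A → ω ∈ B) :
    μ.real A ≤ μ.real B := by
  rw [measureReal_def, measureReal_def]
  exact ENNReal.toReal_mono (measure_ne_top μ B)
    (measure_mono_ae (hlat.mono fun ω hω hA => h ω hω hA))

/-- **Initial estimate** (Kesten 1982, (5.6)): the annulus event `A(0; N, R)` is covered by four
short-way rectangle crossings, each a symmetric image (translation by `kℤ²`, transposition) of a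
sub-crossing of the given rectangle crossing `H([a, b] × [lo, hi])`; hence
`μ(A(0; N, R)) ≤ 4 μ(H([a, b] × [lo, hi]))`.  The arithmetic side conditions say that the right
piece `[N, R] × [-R, R]` and the left piece `[-R, -N] × [-R, R]` are wider and shorter than the
translates of `[a, b] × [lo, hi]` by `k t`, `k t'`. -/
theorem real_annulusCross_le_four_mul (k : ℕ)
    (hlat : ∀ᵐ ω ∂μ, ω ⊆ (zdGraph 2).edgeSet)
    (hshift : ∀ (t : Site 2) (A : Set (BondConfig (Site 2))),
      μ.real (BondConfig.relabel (sym2Equiv (Site.shift ((k : ℤ) • t))) ⁻¹' A) = μ.real A)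
    (htrans : ∀ A : Set (BondConfig (Site 2)),
      μ.real (BondConfig.relabel (sym2Equiv (transposeIso.toEquiv : Site 2 ≃ Site 2)) ⁻¹' A) =
        μ.real A)
    {N R : ℕ} (hNR : N < R) {a b lo hi : ℤ} (t t' : Site 2)
    (hr1 : (N : ℤ) ≤ a + k * t 0) (hab : a ≤ b) (hr3 : b + k * t 0 ≤ R)
    (hr4 : lo + k * t 1 ≤ -(R : ℤ)) (hr5 : (R : ℤ) ≤ hi + k * t 1)
    (hl1 : -(R : ℤ) ≤ a + k * t' 0) (hl3 : b + k * t' 0 ≤ -(N : ℤ))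
    (hl4 : lo + k * t' 1 ≤ -(R : ℤ)) (hl5 : (R : ℤ) ≤ hi + k * t' 1) :
    μ.real (annulusCross[0, N, R]) ≤ 4 * μ.real (hCross[a, b, lo, hi]) := by
  have hsub : μ.real (annulusCross[0, N, R]) ≤
      μ.real (hCross[(N : ℤ), R, (-(R : ℤ)), R] ∪ hCross[(-(R : ℤ)), (-(N : ℤ)), (-(R : ℤ)), R] ∪
        vCross[(-(R : ℤ)), R, N, R] ∪ vCross[(-(R : ℤ)), R, (-(R : ℤ)), (-(N : ℤ))]) := by
    refine real_mono_of_lattice μ hlat fun ω hω h => ?_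
    have h4 := annulusCross_subset_union hω hNR h
    simp only [Pi.zero_apply, zero_add, zero_sub] at h4
    simp only [Set.mem_union]
    rcases h4 with h | h | h | h
    · exact Or.inl (Or.inl (Or.inl h))
    · exact Or.inl (Or.inl (Or.inr h))
    · exact Or.inl (Or.inr h)
    · exact Or.inr h
  have hshift' : ∀ (s : Site 2) (a' b' lo' hi' : ℤ),
      μ.real (hCross[(a' + k * s 0), (b' + k * s 0), (lo' + k * s 1), (hi' + k * s 1)]) =
        μ.real (hCross[a', b', lo', hi']) := by
    intro s a' b' lo' hi'
    have e0 : ((k : ℤ) • s) 0 = k * s 0 := by simp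
    have e1 : ((k : ℤ) • s) 1 = k * s 1 := by simp
    rw [← hshift s (hCross[(a' + k * s 0), (b' + k * s 0), (lo' + k * s 1), (hi' + k * s 1)]), ← e0, ← e1,
      preimage_shift_hCross]
  have hHr : μ.real (hCross[(N : ℤ), R, (-(R : ℤ)), R]) ≤ μ.real (hCross[a, b, lo, hi]) := by
    rw [← hshift' t a b lo hi]
    exact real_mono_of_lattice μ hlat fun ω hω h => hCross_mono hω hr1 (by omega) hr3 hr4 hr5 h
  have hHl : μ.real (hCross[(-(R : ℤ)), (-(N : ℤ)), (-(R : ℤ)), R]) ≤ μ.real (hCross[a, b, lo, hi]) := by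
    rw [← hshift' t' a b lo hi]
    exact real_mono_of_lattice μ hlat fun ω hω h => hCross_mono hω hl1 (by omega) hl3 hl4 hl5 h
  have hVt : μ.real (vCross[(-(R : ℤ)), R, N, R]) = μ.real (hCross[(N : ℤ), R, (-(R : ℤ)), R]) := by
    rw [← preimage_transpose_hCross, htrans]
  have hVb : μ.real (vCross[(-(R : ℤ)), R, (-(R : ℤ)), (-(N : ℤ))]) =
      μ.real (hCross[(-(R : ℤ)), (-(N : ℤ)), (-(R : ℤ)), R]) := by
    rw [← preimage_transpose_hCross, htrans]
  refine hsub.trans ?_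
  refine (measureReal_union_le _ _).trans ?_
  refine (add_le_add ((measureReal_union_le _ _).trans
    (add_le_add (measureReal_union_le _ _) le_rfl)) le_rfl).trans ?_
  rw [hVt, hVb]
  linarith

/-- **Renormalisation inequality** (Kesten 1982, Lemma 5.2): for `N ∈ kℤ_{>0}` with `r < 3N`,
`μ(A(0; 6N, 24N)) ≤ 17689 · μ(A(0; N, 4N))²`.  The path of `A(0; 6N, 24N)` gives two annulus
events of the grid `2Nℤ²` (`exists_pair_of_annulusCross`) determined by boxes at sup-distance
`≥ 3N > r`, whose probabilities multiply (`hindep`) and equal `μ(A(0; N, 4N))` (`hshift`); the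
constant is the number `361 · 49` of pairs of grid points. -/
theorem real_annulusCross_renorm (k r : ℕ)
    (hlat : ∀ᵐ ω ∂μ, ω ⊆ (zdGraph 2).edgeSet)
    (hshift : ∀ (t : Site 2) (A : Set (BondConfig (Site 2))),
      μ.real (BondConfig.relabel (sym2Equiv (Site.shift ((k : ℤ) • t))) ⁻¹' A) = μ.real A)
    (hindep : ∀ (U V : Finset (Site 2)),
      (∀ u ∈ U, ∀ v ∈ V, (r : ℤ) < |u 0 - v 0| ∨ (r : ℤ) < |u 1 - v 1|) →
      ∀ (A B : Set (BondConfig (Site 2))), DeterminedBy A ↑U.sym2 → DeterminedBy B ↑V.sym2 →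
        MeasurableSet A → MeasurableSet B → μ.real (A ∩ B) ≤ μ.real A * μ.real B)
    {N n' : ℕ} (hN : 0 < N) (hkN : N = k * n') (hrN : r + 1 ≤ 3 * N) :
    μ.real (annulusCross[0, (6 * N), (24 * N)]) ≤ 17689 * μ.real (annulusCross[0, N, (4 * N)]) ^ 2 := by
  classical
  set u := μ.real (annulusCross[0, N, (4 * N)]) with hu
  set A : ℤ × ℤ → Set (BondConfig (Site 2)) :=
    fun q => annulusCross[![2 * N * q.1, 2 * N * q.2], N, (4 * N)] with hAdef
  have hA : ∀ q : ℤ × ℤ, μ.real (A q) = u := by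
    intro q
    have key := hshift ![2 * n' * q.1, 2 * n' * q.2] (A q)
    have hv : (0 : Site 2) + (k : ℤ) • ![2 * (n' : ℤ) * q.1, 2 * n' * q.2] =
        ![2 * (N : ℤ) * q.1, 2 * N * q.2] := by
      ext i; fin_cases i <;> simp [hkN] <;> ring
    rw [hu, ← key, hAdef]
    dsimp only
    rw [← hv, preimage_shift_annulusCross]
  set G : Finset (ℤ × ℤ) := ((Finset.Icc (-9 : ℤ) 9) ×ˢ (Finset.Icc (-9 : ℤ) 9)).filter
    (fun q => 17 * (N : ℤ) ≤ |2 * N * q.1| ∨ 17 * (N : ℤ) ≤ |2 * N * q.2|) with hGdef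
  set G' : Finset (ℤ × ℤ) := (Finset.Icc (-3 : ℤ) 3) ×ˢ (Finset.Icc (-3 : ℤ) 3) with hG'def
  have hincl : μ.real (annulusCross[0, (6 * N), (24 * N)]) ≤
      μ.real (⋃ p ∈ G ×ˢ G', A p.1 ∩ A p.2) := by
    refine real_mono_of_lattice μ hlat fun ω hω h => ?_
    obtain ⟨q₀, q₁, q₀', q₁', hq, hfar, hq', hout, hin⟩ := exists_pair_of_annulusCross hω hN h
    simp only [Set.mem_iUnion, exists_prop]
    refine ⟨((q₀, q₁), (q₀', q₁')), ?_, hout, hin⟩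
    rw [Finset.mem_product, hGdef, hG'def, Finset.mem_filter, Finset.mem_product,
      Finset.mem_product, Finset.mem_Icc, Finset.mem_Icc, Finset.mem_Icc, Finset.mem_Icc]
    exact ⟨⟨⟨⟨hq.1, hq.2.1⟩, hq.2.2.1, hq.2.2.2⟩, hfar⟩, ⟨hq'.1, hq'.2.1⟩, hq'.2.2.1, hq'.2.2.2⟩
  have hN' : (0 : ℤ) < N := by exact_mod_cast hN
  have hrN' : (r : ℤ) + 1 ≤ 3 * N := by exact_mod_cast hrN
  have hpair : ∀ p ∈ G ×ˢ G', μ.real (A p.1 ∩ A p.2) ≤ u * u := by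
    intro p hp
    rw [Finset.mem_product, hGdef, hG'def, Finset.mem_filter, Finset.mem_product,
      Finset.mem_product, Finset.mem_Icc, Finset.mem_Icc, Finset.mem_Icc, Finset.mem_Icc] at hp
    obtain ⟨⟨-, hfar⟩, ⟨hq0', hq0''⟩, hq1', hq1''⟩ := hp
    rw [show u * u = μ.real (A p.1) * μ.real (A p.2) by rw [hA, hA]]
    refine hindep _ _ ?_ _ _ (determinedBy_annulusCross _ _ _) (determinedBy_annulusCross _ _ _)
      (measurableSet_annulusCross _ _ _) (measurableSet_annulusCross _ _ _)
    intro x hx y hy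
    simp only [mem_rect, Matrix.cons_val_zero, Matrix.cons_val_one] at hx hy
    push_cast at hx hy
    have hb1 : 2 * (N : ℤ) * p.2.1 ≤ 6 * N := by nlinarith
    have hb2 : -(6 * (N : ℤ)) ≤ 2 * N * p.2.1 := by nlinarith
    have hb3 : 2 * (N : ℤ) * p.2.2 ≤ 6 * N := by nlinarith
    have hb4 : -(6 * (N : ℤ)) ≤ 2 * N * p.2.2 := by nlinarith
    rw [lt_abs, lt_abs]
    rcases hfar with hfar | hfar <;> (rw [le_abs'] at hfar; omega)
  calc μ.real (annulusCross[0, (6 * N), (24 * N)])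
      ≤ μ.real (⋃ p ∈ G ×ˢ G', A p.1 ∩ A p.2) := hincl
    _ ≤ ∑ p ∈ G ×ˢ G', μ.real (A p.1 ∩ A p.2) := measureReal_biUnion_finset_le _ _
    _ ≤ ∑ p ∈ G ×ˢ G', u * u := Finset.sum_le_sum hpair
    _ = (G ×ˢ G').card * (u * u) := by rw [Finset.sum_const, nsmul_eq_mul]
    _ ≤ 17689 * u ^ 2 := by
        have h1 : G.card ≤ 361 := by
          rw [hGdef]
          refine (Finset.card_filter_le _ _).trans ?_
          simp only [Finset.card_product, Int.card_Icc]
          decide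
        have h2 : G'.card ≤ 49 := by
          simp only [hG'def, Finset.card_product, Int.card_Icc]
          decide
        have h3 : (G ×ˢ G').card ≤ 17689 := by
          rw [Finset.card_product]; nlinarith
        have h4 : ((G ×ˢ G').card : ℝ) ≤ 17689 := by exact_mod_cast h3
        have hu0 : 0 ≤ u * u := mul_self_nonneg u
        nlinarith

/-- **Iterating the renormalisation**: if `17689 · μ(A(0; N, 4N)) ≤ 1` then
`μ(A(0; 6ʲN, 4·6ʲN)) ≤ μ(A(0; N, 4N))` for every `j` (Kesten 1982, proof of Thm. 5.1). -/
theorem real_annulusCross_iter (k r : ℕ)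
    (hlat : ∀ᵐ ω ∂μ, ω ⊆ (zdGraph 2).edgeSet)
    (hshift : ∀ (t : Site 2) (A : Set (BondConfig (Site 2))),
      μ.real (BondConfig.relabel (sym2Equiv (Site.shift ((k : ℤ) • t))) ⁻¹' A) = μ.real A)
    (hindep : ∀ (U V : Finset (Site 2)),
      (∀ u ∈ U, ∀ v ∈ V, (r : ℤ) < |u 0 - v 0| ∨ (r : ℤ) < |u 1 - v 1|) →
      ∀ (A B : Set (BondConfig (Site 2))), DeterminedBy A ↑U.sym2 → DeterminedBy B ↑V.sym2 →
        MeasurableSet A → MeasurableSet B → μ.real (A ∩ B) ≤ μ.real A * μ.real B)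
    {N n' : ℕ} (hN : 0 < N) (hkN : N = k * n') (hrN : r + 1 ≤ 3 * N)
    (h0 : 17689 * μ.real (annulusCross[0, N, (4 * N)]) ≤ 1) (j : ℕ) :
    μ.real (annulusCross[0, (6 ^ j * N), (4 * (6 ^ j * N))]) ≤ μ.real (annulusCross[0, N, (4 * N)]) := by
  suffices H : μ.real (annulusCross[0, (6 ^ j * N), (4 * (6 ^ j * N))]) ≤
      μ.real (annulusCross[0, N, (4 * N)]) ∧
      17689 * μ.real (annulusCross[0, (6 ^ j * N), (4 * (6 ^ j * N))]) ≤ 1 from H.1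
  induction j with
  | zero => simp only [pow_zero, one_mul]; exact ⟨le_rfl, h0⟩
  | succ j ih =>
    have hNj : 0 < 6 ^ j * N := by positivity
    have hle : N ≤ 6 ^ j * N := Nat.le_mul_of_pos_left N (by positivity)
    have hstep := real_annulusCross_renorm μ k r hlat hshift hindep hNj (n' := 6 ^ j * n')
      (by rw [hkN]; ring) (by omega)
    have e1 : 6 ^ (j + 1) * N = 6 * (6 ^ j * N) := by ring
    have e2 : 4 * (6 * (6 ^ j * N)) = 24 * (6 ^ j * N) := by ring
    rw [e1, e2]
    obtain ⟨ih1, ih2⟩ := ih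
    have hu0 : 0 ≤ μ.real (annulusCross[0, (6 ^ j * N), (4 * (6 ^ j * N))]) := measureReal_nonneg
    constructor
    · nlinarith
    · nlinarith

/-- **Covering estimate**: a horizontal crossing of `[a, b] × [lo, hi]` starting within `N` of the
line `x₀ = k t₀` and reaching `x₀ = b ≥ k t₀ + R` forces an annulus event `A(y; N, R)` at one of the
grid points `y = (k t₀, 2N q)`, `⌊(lo + N)/2N⌋ ≤ q ≤ ⌊(hi + N)/2N⌋`; by translation invariance each
has probability `μ(A(0; N, R))`. -/
theorem real_hCross_le_card_mul (k : ℕ)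
    (hlat : ∀ᵐ ω ∂μ, ω ⊆ (zdGraph 2).edgeSet)
    (hshift : ∀ (t : Site 2) (A : Set (BondConfig (Site 2))),
      μ.real (BondConfig.relabel (sym2Equiv (Site.shift ((k : ℤ) • t))) ⁻¹' A) = μ.real A)
    {a b lo hi : ℤ} {N R n' : ℕ} (hN : 0 < N) (hNR : N ≤ R) (hkN : N = k * n')
    (t₀ : ℤ) (hy₀ : |a - k * t₀| ≤ N) (hb : (k : ℤ) * t₀ + R ≤ b) :
    μ.real (hCross[a, b, lo, hi]) ≤
      ((Finset.Icc ((lo + N) / (2 * N)) ((hi + N) / (2 * N))).card : ℝ) *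
        μ.real (annulusCross[0, N, R]) := by
  classical
  set A : ℤ → Set (BondConfig (Site 2)) := fun q => annulusCross[![(k : ℤ) * t₀, 2 * N * q], N, R]
    with hAdef
  have hA : ∀ q, μ.real (A q) = μ.real (annulusCross[0, N, R]) := by
    intro q
    have key := hshift ![t₀, 2 * n' * q] (A q)
    have hv : (0 : Site 2) + (k : ℤ) • ![t₀, 2 * (n' : ℤ) * q] = ![(k : ℤ) * t₀, 2 * N * q] := by
      ext i; fin_cases i
      · simp
      · simp [hkN]; ring
    rw [← key, hAdef]
    dsimp only
    rw [← hv, preimage_shift_annulusCross]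
  have hincl : μ.real (hCross[a, b, lo, hi]) ≤
      μ.real (⋃ q ∈ Finset.Icc ((lo + N) / (2 * N)) ((hi + N) / (2 * N)), A q) := by
    refine real_mono_of_lattice μ hlat fun ω hω h => ?_
    obtain ⟨q, hq1, hq2, hq⟩ := exists_annulusCross_of_hCross hω hN hNR hy₀ hb h
    simp only [Set.mem_iUnion, Finset.mem_Icc, exists_prop]
    exact ⟨q, ⟨hq1, hq2⟩, hq⟩
  calc μ.real (hCross[a, b, lo, hi])
      ≤ μ.real (⋃ q ∈ Finset.Icc ((lo + N) / (2 * N)) ((hi + N) / (2 * N)), A q) := hincl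
    _ ≤ ∑ q ∈ Finset.Icc ((lo + N) / (2 * N)) ((hi + N) / (2 * N)), μ.real (A q) :=
        measureReal_biUnion_finset_le _ _
    _ = ∑ q ∈ Finset.Icc ((lo + N) / (2 * N)) ((hi + N) / (2 * N)), μ.real (annulusCross[0, N, R]) :=
        Finset.sum_congr rfl fun q _ => hA q
    _ = _ := by rw [Finset.sum_const, nsmul_eq_mul]

end Measure

/-! ### Arithmetic helpers for the assembly -/

section Helpers

open MeasureTheory

/-- **Translation invariance of rectangle crossings**, solved form: if `[a', b'] × [lo', hi']` is
the translate of `[a, b] × [lo, hi]` by `k s`, the two horizontal crossings are equiprobable. -/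
theorem real_hCross_shift_eq (μ : Measure (BondConfig (Site 2))) (k : ℕ)
    (hshift : ∀ (t : Site 2) (A : Set (BondConfig (Site 2))),
      μ.real (BondConfig.relabel (sym2Equiv (Site.shift ((k : ℤ) • t))) ⁻¹' A) = μ.real A)
    (s : Site 2) {a b lo hi a' b' lo' hi' : ℤ} (ha : a' = a + k * s 0) (hb : b' = b + k * s 0)
    (hlo : lo' = lo + k * s 1) (hhi : hi' = hi + k * s 1) :
    μ.real (hCross[a', b', lo', hi']) = μ.real (hCross[a, b, lo, hi]) := by
  subst ha hb hlo hhi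
  have e0 : ((k : ℤ) • s) 0 = k * s 0 := by simp
  have e1 : ((k : ℤ) • s) 1 = k * s 1 := by simp
  rw [← hshift s (hCross[(a + k * s 0), (b + k * s 0), (lo + k * s 1), (hi + k * s 1)]), ← e0, ← e1,
    preimage_shift_hCross]

/-- **Choice of scale**: for `0 < A ≤ B` there is `j` with `6ʲ A ≤ B < 6ʲ⁺¹ A`. -/
theorem exists_scale (A B : ℕ) (hA : 0 < A) (hAB : A ≤ B) :
    ∃ j : ℕ, 6 ^ j * A ≤ B ∧ B < 6 ^ (j + 1) * A := by
  classical
  have hex : ∃ j : ℕ, B < 6 ^ (j + 1) * A := by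
    refine ⟨B, ?_⟩
    have h1 : B < 6 ^ B := Nat.lt_pow_self (by norm_num)
    have h2 : 6 ^ B ≤ 6 ^ (B + 1) := Nat.pow_le_pow_right (by norm_num) (by omega)
    have h3 : 6 ^ (B + 1) ≤ 6 ^ (B + 1) * A := Nat.le_mul_of_pos_right _ hA
    omega
  refine ⟨Nat.find hex, ?_, Nat.find_spec hex⟩
  rcases h : Nat.find hex with _ | j
  · simpa using hAB
  · have hmin := Nat.find_min hex (m := j) (by omega)
    exact not_lt.1 hmin

/-- The number of grid indices `q` with `⌊(lo + N)/2N⌋ ≤ q ≤ ⌊(hi + N)/2N⌋` is at most `B + 1 - A`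
when `2N·A ≤ lo + N` and `hi + N < 2N·(B + 1)`. -/
theorem card_Icc_grid_le {N : ℕ} (hN : 0 < N) {lo hi A B : ℤ} (hlo : A * (2 * N) ≤ lo + N)
    (hhi : hi + N < (B + 1) * (2 * N)) :
    ((Finset.Icc ((lo + N) / (2 * N)) ((hi + N) / (2 * N))).card : ℝ) ≤ ((B + 1 - A).toNat : ℕ) := by
  have h2N : (0 : ℤ) < 2 * N := by positivity
  have h1 : A ≤ (lo + N) / (2 * N) := (Int.le_ediv_iff_mul_le h2N).2 hlo
  have h2 : (hi + N) / (2 * N) ≤ B := Int.lt_add_one_iff.1 ((Int.ediv_lt_iff_lt_mul h2N).2 hhi)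
  have h3 : ((hi + N) / (2 * N) + 1 - (lo + N) / (2 * N)).toNat ≤ (B + 1 - A).toNat :=
    Int.toNat_le_toNat (by omega)
  rw [Int.card_Icc]
  exact_mod_cast h3

/-- **Headline of this support file** (registered sub-stub `stub_finiteSizeCriteria_measure` of
`stub_finiteSizeCriteria`): for a measure carried by lattice configurations, an inclusion valid on lattice configurations gives an inequality of probabilities (`real_mono_of_lattice`). -/
theorem stub_finiteSizeCriteria_measure :
    ∀ (μ : Measure (BondConfig (Site 2))) [IsProbabilityMeasure μ], (∀ᵐ ω ∂μ, ω ⊆ (zdGraph 2).edgeSet) → ∀ (A B : Set (BondConfig (Site 2))), (∀ ω : BondConfig (Site 2), ω ⊆ (zdGraph 2).edgeSet → ω ∈ A → ω ∈ B) → μ.real A ≤ μ.real B :=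
  fun μ _ hlat _ _ h => real_mono_of_lattice μ hlat h

end Helpers

end FSC

end Summit.CriticalPhenomena.CardyFormulaZ2.Cruxes.CriticalPathRSW.FiniteSizeEnvelope
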